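import Literature.NumberTheory.Sieve.HeathBrownCubicTypeIICauchy
import Literature.NumberTheory.Sieve.HeathBrownCubicLatticeGeometry
import HarnessLib

/-!
# Heath-Brown's Lemma 3.10, §11 pp. 69–71: the off-diagonal terms, `α̂ = ±D⁻¹(β̂₁ ∧ β̂₂)`, and `S₃`

Support for the proof of **Lemma 3.10** of D. R. Heath-Brown, *Primes represented by `x³ + 2y³`*,
Acta Math. 186 (2001), §11 pp. 69–71:

> "To handle the off-diagonal terms we write `α = r + s2^{1/3} + t4^{1/3}` and `β_i = u_i + v_i2^{1/3} + w_i4^{1/3}`.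
> It will also be convenient to set `α̂ = (r, s, t)`, `β̃_i = (w_i, v_i, u_i)`. The conditions
> `αβ_i = x_i + y_i2^{1/3}` for `i = 1, 2` then yield `rw_i + sv_i + tu_i = 0`. Thus, unless `β₁ = β₂`,
> we see that the primitive vector `α̂ ∈ ℤ³` must be given by `α̂ = ±D⁻¹(v₁u₂ − u₁v₂, u₁w₂ − w₁u₂, w₁v₂ − v₁w₂)`
> (11.4) where `D = h.c.f.(…)`. … `D ≪ VX⁻¹` (11.7). Our next task in this section is to show that
> values of `D` which are appreciably smaller than `VX⁻¹` make a negligible contribution … we shall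
> deal with the case `D ≤ VX⁻¹Y⁻¹` … `|F_{β₁}F_{β₂}| ≤ ½(|F_{β₁}|² + |F_{β₂}|²)`, so that it suffices to
> estimate `S₃ = ∑ τ(β₁)² ∑ W(𝐱₁)W(𝐱₂)δ` … `β̂₂` is confined to a circular cylinder of radius `O(DXV^{−2/3})`
> and length `O(V^{1/3})` … We may now sum over all `D ≤ VX⁻¹Y⁻¹` to find that `S₃ ≪ VXY⁻¹(log X)^c`."

All PROVED here (we follow the plan of p. 71 but count directly with the cylinder count of
`HeathBrownCubicLatticeGeometry`, dispensing with the covering by cubes and the case `D ≶ V^{3/4}X⁻¹`):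

* `rev` (`(r,s,t) ↦ (t,s,r)`: the third coordinate of `α̂β̂` is `rev(α̂) · β̂`), `hcf3` (`h.c.f.` of an
  integer vector), `divVec`, primitivity of `v / h.c.f.(v)`;
* **`exists_sign_smul_rev_eq`** — (11.4): for primitive `α̂` with `W(α̂β̂₁) = W(α̂β̂₂) = 1` and
  `β̂₁ ∧ β̂₂ ≠ 0`, `D · rev(α̂) = ± (β̂₁ ∧ β̂₂)`, `D = h.c.f.(β̂₁ ∧ β̂₂)`; `cross3_ne_zero_of_ne` (distinct
  primitive `β̂_i` with `σ₁(β_i) > 0` are not parallel);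
* `nAB` (the number of `α̂` for a pair), `nAB_le_two`, **`S2sum_eq_sum_offDiag`** (`S₂` as a sum over
  pairs `β₁ ≠ β₂`), `S3sum`/`S4sum` (the split at `D ≤ Δ₀` / `D > Δ₀`, Heath-Brown's `Δ₀ = VX⁻¹Y⁻¹`),
  `S2sum_eq_S3_add_S4`;
* `supZ_cross3_le_of_nAB` (`|β̂₁ ∧ β̂₂|_∞ ≤ D · 7X/T`, i.e. (11.6) `|α̂| ≪ XV^{−1/3}` turned round),
  `card_b2_le` (for fixed `β̂₁`, `D`: the `β̂₂ ≡ λβ̂₁ (mod D)` in the cylinder number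
  `≤ D (6T/D + 1)(56X/T² + 1)²`), and **`abs_S3sum_le`**:
  `|S₃| ≤ 2 (∑_β F_β²) · Δ₀ (6T + Δ₀) (56X/T² + 1)²` — with `∑ F² ≪ V(log X)^c` (Lemma 4.5) and
  `Δ₀ = V/(XY)` this is the printed `S₃ ≪ VXY⁻¹(log X)^c`.

## References

* D. R. Heath-Brown, *Primes represented by `x³ + 2y³`*, Acta Math. 186 (2001), §11 pp. 69–71,
  (11.4)–(11.8), Lemma 11.2. [cite: HeathBrownActa2001, §11 (11.4)]
* G. Harman, *Prime-Detecting Sieves* (2007), §13.8, (13.8.3)–(13.8.6). [cite: Harman2007, §13.8]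

## Mathlib / tree search

Tree: `HeathBrownCubicTypeIICauchy` (`S2sum`, `Fb`, `Wab`, `Abox`, `Bbox`, `cube`),
`HeathBrownCubicLatticeGeometry` (`supZ`, `dot3`, `cross3_eq_smul_of_dot_eq_zero`,
`exists_eq_smul_of_cross3_eq_zero`, `card_filter_abs_cross3_le`), `HeathBrownCubicLemma111`
(`IsPrimitiveVec`, `DvdVec`, `exists_dot_eq_one`, `modEq_smul_of_dvd_cross3`), `HeathBrownCubicWindow`
(`exists_abs_coord_gt_of_inWindow`). Mathlib: `Int.gcd`, `Finset.offDiag`, `Finset.card_le_mul_card_image`.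
-/

noncomputable section

open Finset NumberField

namespace Literature.NumberTheory.Sieve.CubicSieve

open LFunctions.CubeRootTwoField CubicPrimes

/-! ### `rev`, the h.c.f. of a vector, and (11.4) -/

/-- Coordinate reversal `(r, s, t) ↦ (t, s, r)` (Heath-Brown's `β̃ = (w, v, u)` for `β̂ = (u, v, w)`).
[cite: HeathBrownActa2001, §11 p. 69] -/
def rev (v : ℤ × ℤ × ℤ) : ℤ × ℤ × ℤ := (v.2.2, v.2.1, v.1)

/-- `rev` is an involution. [folklore] -/
@[simp] theorem rev_rev (v : ℤ × ℤ × ℤ) : rev (rev v) = v := rfl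

/-- `rev` is injective. [folklore] -/
theorem rev_injective : Function.Injective rev := fun v w h => by
  rw [← rev_rev v, ← rev_rev w, h]

/-- `rev (μ • v) = μ • rev v`. [folklore] -/
theorem rev_smul (μ : ℤ) (v : ℤ × ℤ × ℤ) : rev (μ • v) = μ • rev v := by
  simp [rev]

/-- `rev (-v) = -rev v`. [folklore] -/
theorem rev_neg (v : ℤ × ℤ × ℤ) : rev (-v) = -rev v := by simp [rev]

/-- `supZ (rev v) = supZ v`. [folklore] -/
theorem supZ_rev (v : ℤ × ℤ × ℤ) : supZ (rev v) = supZ v := by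
  simp only [supZ, rev]
  rw [max_comm |v.2.1|, ← max_assoc, max_comm |v.2.2|, max_assoc, max_comm |v.2.2|]

/-- `rev` preserves primitivity. [folklore] -/
theorem isPrimitiveVec_rev {v : ℤ × ℤ × ℤ} (hv : IsPrimitiveVec v) : IsPrimitiveVec (rev v) :=
  fun d h1 h2 h3 => hv d h3 h2 h1

/-- **"The conditions `αβ_i = x_i + y_i2^{1/3}` yield `rw_i + sv_i + tu_i = 0`"**: the third coordinate
of `α̂β̂` is `rev(α̂) · β̂`. [cite: HeathBrownActa2001, §11 p. 69] -/
theorem imulVec_thd (a b : ℤ × ℤ × ℤ) : (imulVec a b).2.2 = dot3 (rev a) b := by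
  simp only [imulVec, dot3, rev]; ring

/-- `W(α̂β̂) = 1` forces `rev(α̂) · β̂ = 0`. [cite: HeathBrownActa2001, §11 p. 69] -/
theorem dot3_rev_eq_zero_of_Wab {X η : ℝ} {a b : ℤ × ℤ × ℤ} (h : Wab X η a b) : dot3 (rev a) b = 0 := by
  rw [Wab, mem_boxVec_iff] at h
  obtain ⟨xy, -, hxy⟩ := h
  rw [← imulVec_thd, ← hxy]

/-- The h.c.f. of the coordinates of an integer vector. [cite: HeathBrownActa2001, §11 (11.4)] -/
def hcf3 (v : ℤ × ℤ × ℤ) : ℕ := Int.gcd (Int.gcd v.1 v.2.1) v.2.2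

/-- `hcf3 v` divides each coordinate. [folklore] -/
theorem hcf3_dvd (v : ℤ × ℤ × ℤ) : DvdVec (hcf3 v : ℤ) v := by
  refine ⟨?_, ?_, ?_⟩
  · exact (Int.gcd_dvd_left _ v.2.2).trans (Int.gcd_dvd_left v.1 v.2.1)
  · exact (Int.gcd_dvd_left _ v.2.2).trans (Int.gcd_dvd_right v.1 v.2.1)
  · exact Int.gcd_dvd_right _ v.2.2

/-- A common divisor of the coordinates divides `hcf3`. [folklore] -/
theorem dvd_hcf3 {d : ℤ} {v : ℤ × ℤ × ℤ} (h : DvdVec d v) : d ∣ (hcf3 v : ℤ) := by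
  obtain ⟨h1, h2, h3⟩ := h
  exact Int.dvd_coe_gcd (Int.dvd_coe_gcd h1 h2) h3

/-- `hcf3 v = 0 ↔ v = 0`. [folklore] -/
theorem hcf3_eq_zero_iff (v : ℤ × ℤ × ℤ) : hcf3 v = 0 ↔ v = 0 := by
  constructor
  · intro h
    obtain ⟨h1, h2, h3⟩ := hcf3_dvd v
    rw [h, Nat.cast_zero, zero_dvd_iff] at h1 h2 h3
    ext <;> assumption
  · rintro rfl; simp [hcf3]

/-- `hcf3 v ≥ 1` for `v ≠ 0`. [folklore] -/
theorem one_le_hcf3 {v : ℤ × ℤ × ℤ} (hv : v ≠ 0) : 1 ≤ hcf3 v :=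
  Nat.one_le_iff_ne_zero.mpr fun h => hv ((hcf3_eq_zero_iff v).mp h)

/-- `hcf3 (μ • p) = |μ|` for a primitive `p`. [folklore] -/
theorem hcf3_smul_of_isPrimitiveVec {p : ℤ × ℤ × ℤ} (hp : IsPrimitiveVec p) (μ : ℤ) :
    (hcf3 (μ • p) : ℤ) = |μ| := by
  apply Int.dvd_antisymm (by positivity) (abs_nonneg μ)
  · -- `hcf3 (μ p) ∣ μ`: write `hcf3 = g`; `g ∣ μ p_i` for all `i`; with `c · p = 1`, `g ∣ μ`
    obtain ⟨c, hc⟩ := exists_dot_eq_one hp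
    obtain ⟨h1, h2, h3⟩ := hcf3_dvd (μ • p)
    simp only [Prod.smul_fst, Prod.smul_snd, smul_eq_mul] at h1 h2 h3
    have : (hcf3 (μ • p) : ℤ) ∣ μ * (c.1 * p.1 + c.2.1 * p.2.1 + c.2.2 * p.2.2) := by
      have e : μ * (c.1 * p.1 + c.2.1 * p.2.1 + c.2.2 * p.2.2) = c.1 * (μ * p.1) + c.2.1 * (μ * p.2.1) + c.2.2 * (μ * p.2.2) := by ring
      rw [e]
      exact dvd_add (dvd_add (dvd_mul_of_dvd_right h1 _) (dvd_mul_of_dvd_right h2 _)) (dvd_mul_of_dvd_right h3 _)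
    rw [hc, mul_one] at this
    exact (dvd_abs _ _).mpr this
  · rw [abs_dvd]
    exact dvd_hcf3 ⟨⟨p.1, by simp⟩, ⟨p.2.1, by simp⟩, ⟨p.2.2, by simp⟩⟩

/-- Componentwise exact division of an integer vector. [folklore] -/
def divVec (v : ℤ × ℤ × ℤ) (d : ℤ) : ℤ × ℤ × ℤ := (v.1 / d, v.2.1 / d, v.2.2 / d)

/-- `d • (v / d) = v` when `d ∣ v`. [folklore] -/
theorem smul_divVec {d : ℤ} {v : ℤ × ℤ × ℤ} (h : DvdVec d v) : d • divVec v d = v := by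
  obtain ⟨h1, h2, h3⟩ := h
  ext <;> simp [divVec, Int.mul_ediv_cancel' h1, Int.mul_ediv_cancel' h2, Int.mul_ediv_cancel' h3]

/-- `v / hcf3(v)` is primitive for `v ≠ 0`. [folklore] -/
theorem isPrimitiveVec_divVec_hcf3 {v : ℤ × ℤ × ℤ} (hv : v ≠ 0) : IsPrimitiveVec (divVec v (hcf3 v : ℤ)) := by
  intro d h1 h2 h3
  set g : ℤ := (hcf3 v : ℤ) with hg
  have hg1 : 1 ≤ g := by rw [hg]; exact_mod_cast one_le_hcf3 hv
  have hdiv := smul_divVec (hcf3_dvd v)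
  rw [← hg] at hdiv
  -- `d g` divides `v`, hence divides `g`
  have hdg : DvdVec (d * g) v := by
    rw [← hdiv]
    refine ⟨?_, ?_, ?_⟩ <;> simp only [Prod.smul_fst, Prod.smul_snd, smul_eq_mul]
    · rw [mul_comm d]; exact mul_dvd_mul_left g h1
    · rw [mul_comm d]; exact mul_dvd_mul_left g h2
    · rw [mul_comm d]; exact mul_dvd_mul_left g h3
  have := dvd_hcf3 hdg
  rw [← hg] at this
  have hd : d * g ∣ 1 * g := by rwa [one_mul]
  exact isUnit_of_dvd_one ((mul_dvd_mul_iff_right (by omega)).mp hd)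

/-- **Distinct primitive `β̂₁, β̂₂` with `σ₁ > 0` are not parallel** ("unless `β₁ = β₂` …"; since they
are primitive, parallel means equal up to sign, and the sign is fixed by `β > 0`). [cite: HeathBrownActa2001, §11 p. 69] -/
theorem cross3_ne_zero_of_ne {b₁ b₂ : ℤ × ℤ × ℤ} (h₁ : IsPrimitiveVec b₁) (h₂ : IsPrimitiveVec b₂)
    (hne : b₁ ≠ b₂) (hpos₁ : 0 < ell (castVec b₁)) (hpos₂ : 0 < ell (castVec b₂)) : cross3 b₁ b₂ ≠ 0 := by
  intro h0
  obtain ⟨μ, hμ⟩ := exists_eq_smul_of_cross3_eq_zero h₁ h0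
  -- `μ` is a unit
  have hμu : IsUnit μ := h₂ μ (by rw [hμ]; simp) (by rw [hμ]; simp) (by rw [hμ]; simp)
  rcases Int.isUnit_iff.mp hμu with rfl | rfl
  · rw [one_smul] at hμ; exact hne hμ.symm
  · have : ell (castVec b₂) = -ell (castVec b₁) := by
      rw [hμ]
      have : castVec ((-1 : ℤ) • b₁) = -castVec b₁ := by
        simp only [castVec, Prod.smul_fst, Prod.smul_snd, smul_eq_mul, neg_one_mul, Int.cast_neg]; rfl
      rw [this, ell_neg]
    linarith

/-- **(11.4): `α̂ = ±D⁻¹(β̂₁ ∧ β̂₂)`**, `D = h.c.f.(β̂₁ ∧ β̂₂)`, for a primitive `α̂` with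
`rev(α̂) ⊥ β̂₁, β̂₂` and `β̂₁ ∧ β̂₂ ≠ 0`, in the form `D · rev(α̂) = ε (β̂₁ ∧ β̂₂)`, `ε = ±1`.
[cite: HeathBrownActa2001, §11 (11.4)] -/
theorem exists_sign_smul_rev_eq {a b₁ b₂ : ℤ × ℤ × ℤ} (ha : IsPrimitiveVec a) (h₁ : dot3 (rev a) b₁ = 0)
    (h₂ : dot3 (rev a) b₂ = 0) (hv : cross3 b₁ b₂ ≠ 0) :
    ∃ ε : ℤ, (ε = 1 ∨ ε = -1) ∧ (hcf3 (cross3 b₁ b₂) : ℤ) • rev a = ε • cross3 b₁ b₂ := by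
  obtain ⟨c, hc⟩ := exists_dot_eq_one (isPrimitiveVec_rev ha)
  have hc' : dot3 c (rev a) = 1 := by simpa [dot3] using hc
  set μ : ℤ := dot3 c (cross3 b₁ b₂) with hμ
  have hvμ : cross3 b₁ b₂ = μ • rev a := cross3_eq_smul_of_dot_eq_zero hc' h₁ h₂
  have hμ0 : μ ≠ 0 := by rintro h; rw [h, zero_smul] at hvμ; exact hv hvμ
  have hD : (hcf3 (cross3 b₁ b₂) : ℤ) = |μ| := by rw [hvμ]; exact hcf3_smul_of_isPrimitiveVec (isPrimitiveVec_rev ha) μ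
  rcases lt_or_gt_of_ne hμ0 with hneg | hpos
  · refine ⟨-1, Or.inr rfl, ?_⟩
    rw [hD, abs_of_neg hneg, hvμ, smul_smul, neg_one_mul]
  · refine ⟨1, Or.inl rfl, ?_⟩
    rw [hD, abs_of_pos hpos, hvμ, one_smul]

/-! ### `S₂` as a sum over pairs, the count of `α̂`, and the split `S₂ = S₃ + S₄` -/

section Defs

variable (X η τ : ℝ) {k : ℕ} (m : Fin k → ℕ) (V T : ℝ)

open scoped Classical in
/-- **The number of `α̂`** (primitive, in `Abox`) with `W(α̂β̂₁) = W(α̂β̂₂) = 1` for the pair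
`(β̂₁, β̂₂)` — Heath-Brown's `∑_{𝐱₁,𝐱₂} W(𝐱₁)W(𝐱₂)δ`. [cite: HeathBrownActa2001, §11 p. 68] -/
def nAB (bb : (ℤ × ℤ × ℤ) × (ℤ × ℤ × ℤ)) : ℕ :=
  #((Abox X T).filter fun a => IsPrimitiveVec a ∧ Wab X η a bb.1 ∧ Wab X η a bb.2)

/-- `D = h.c.f.(β̂₁ ∧ β̂₂)`. [cite: HeathBrownActa2001, §11 (11.4)] -/
def Dhcf (bb : (ℤ × ℤ × ℤ) × (ℤ × ℤ × ℤ)) : ℕ := hcf3 (cross3 bb.1 bb.2)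

open scoped Classical in
/-- **`S₃`**: the part of `S₂` with `D ≤ Δ₀` (Heath-Brown: `D ≤ VX⁻¹Y⁻¹`). [cite: HeathBrownActa2001, §11 p. 70] -/
def S3sum (Δ₀ : ℝ) : ℝ :=
  ∑ bb ∈ ((Bbox T).offDiag).filter (fun bb => (Dhcf bb : ℝ) ≤ Δ₀),
    Fb X τ m V T bb.1 * Fb X τ m V T bb.2 * nAB X η T bb

open scoped Classical in
/-- **`S₄`**: the part of `S₂` with `D > Δ₀` (Lemma 11.2: "subject to the condition `D > VX⁻¹Y⁻¹`").
[cite: HeathBrownActa2001, Lemma 11.2] -/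
def S4sum (Δ₀ : ℝ) : ℝ :=
  ∑ bb ∈ ((Bbox T).offDiag).filter (fun bb => Δ₀ < (Dhcf bb : ℝ)),
    Fb X τ m V T bb.1 * Fb X τ m V T bb.2 * nAB X η T bb

end Defs

variable {X η τ V T : ℝ} {k : ℕ} {m : Fin k → ℕ}

open scoped Classical in
/-- **`S₂ = ∑_{β₁ ≠ β₂} F_{β₁}F_{β₂} · #{α̂}`** (swap the sums over `α̂` and over the pair).
[cite: HeathBrownActa2001, §11 p. 68] -/
theorem S2sum_eq_sum_offDiag :
    S2sum X η τ m V T = ∑ bb ∈ (Bbox T).offDiag, Fb X τ m V T bb.1 * Fb X τ m V T bb.2 * nAB X η T bb := by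
  classical
  rw [S2sum, sum_comm]
  refine sum_congr rfl fun bb _ => ?_
  rw [nAB, card_eq_sum_ones, Nat.cast_sum, mul_sum, sum_filter, sum_filter]
  refine sum_congr rfl fun a _ => ?_
  by_cases ha : IsPrimitiveVec a
  · by_cases hW : Wab X η a bb.1 ∧ Wab X η a bb.2
    · rw [if_pos ha, if_pos hW, if_pos ⟨ha, hW⟩]; simp
    · rw [if_pos ha, if_neg hW, if_neg (fun h => hW h.2)]
  · rw [if_neg ha, if_neg (fun h => ha h.1)]

open scoped Classical in
/-- `S₂ = S₃ + S₄`. [cite: HeathBrownActa2001, §11 p. 70] -/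
theorem S2sum_eq_S3_add_S4 (Δ₀ : ℝ) : S2sum X η τ m V T = S3sum X η τ m V T Δ₀ + S4sum X η τ m V T Δ₀ := by
  classical
  rw [S2sum_eq_sum_offDiag, S3sum, S4sum, ← sum_filter_add_sum_filter_not _ (fun bb => (Dhcf bb : ℝ) ≤ Δ₀)]
  congr 1
  refine sum_congr ?_ fun _ _ => rfl
  ext bb; simp only [mem_filter, not_le]

/-- `F_β ≠ 0` forces: `β` in the window, `β̂` primitive, `V < N(β) ≤ 2V`. [folklore] -/
theorem support_of_Fb_ne_zero {b : ℤ × ℤ × ℤ} (h : Fb X τ m V T b ≠ 0) :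
    InWindow T (coordElt b) ∧ IsPrimitiveVec b ∧ V < (Ideal.absNorm (Ideal.span {coordElt b}) : ℝ) ∧
      (Ideal.absNorm (Ideal.span {coordElt b}) : ℝ) ≤ 2 * V := by
  rw [Fb] at h
  by_cases hw : InWindow T (coordElt b) ∧ IsPrimitiveVec b
  · rw [if_pos hw] at h
    refine ⟨hw.1, hw.2, ?_⟩
    by_contra hN
    exact h (gCut_eq_zero_of_not hN)
  · rw [if_neg hw] at h; exact absurd rfl h

open scoped Classical in
/-- **At most two `α̂` per pair**: `#{α̂} ≤ 2` when `β̂₁ ∧ β̂₂ ≠ 0` (the two signs in (11.4)).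
[cite: HeathBrownActa2001, §11 (11.4)] -/
theorem nAB_le_two {bb : (ℤ × ℤ × ℤ) × (ℤ × ℤ × ℤ)} (hv : cross3 bb.1 bb.2 ≠ 0) : nAB X η T bb ≤ 2 := by
  classical
  set v := cross3 bb.1 bb.2 with hvdef
  set w := divVec v (hcf3 v : ℤ) with hw
  have hDw : (hcf3 v : ℤ) • w = v := smul_divVec (hcf3_dvd v)
  have hD0 : (hcf3 v : ℤ) ≠ 0 := by exact_mod_cast (Nat.one_le_iff_ne_zero.mp (one_le_hcf3 hv))
  have hsub : (Abox X T).filter (fun a => IsPrimitiveVec a ∧ Wab X η a bb.1 ∧ Wab X η a bb.2) ⊆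
      {rev w, rev (-w)} := by
    intro a ha
    rw [mem_filter] at ha
    obtain ⟨-, hprim, hW1, hW2⟩ := ha
    obtain ⟨ε, hε, heq⟩ := exists_sign_smul_rev_eq hprim (dot3_rev_eq_zero_of_Wab hW1)
      (dot3_rev_eq_zero_of_Wab hW2) hv
    rw [← hvdef] at heq
    rw [mem_insert, mem_singleton]
    rcases hε with rfl | rfl
    · left
      have h2 : (hcf3 v : ℤ) • rev a = (hcf3 v : ℤ) • w := by rw [heq, one_smul, hDw]
      have : rev a = w := smul_right_injective _ hD0 h2
      rw [← this, rev_rev]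
    · right
      have h2 : (hcf3 v : ℤ) • rev a = (hcf3 v : ℤ) • (-w) := by rw [heq, neg_one_smul, smul_neg, hDw]
      have : rev a = -w := smul_right_injective _ hD0 h2
      rw [← this, rev_rev]
  calc nAB X η T bb = #((Abox X T).filter (fun a => IsPrimitiveVec a ∧ Wab X η a bb.1 ∧ Wab X η a bb.2)) := rfl
    _ ≤ #({rev w, rev (-w)} : Finset (ℤ × ℤ × ℤ)) := card_le_card hsub
    _ ≤ 2 := card_insert_le _ _ |>.trans (by rw [card_singleton])

/-! ### Geometry of a pair: `|β̂₁ ∧ β̂₂|_∞ ≤ D · 7X/T`, and non-parallelism -/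

/-- `cross3 a (μ • b) = μ • cross3 a b`. [folklore] -/
theorem cross3_smul_right (μ : ℤ) (a b : ℤ × ℤ × ℤ) : cross3 a (μ • b) = μ • cross3 a b := by
  ext <;> simp [cross3] <;> ring

/-- `imulVec a (μ • b) = μ • imulVec a b`. [folklore] -/
theorem imulVec_smul_right (μ : ℤ) (a b : ℤ × ℤ × ℤ) : imulVec a (μ • b) = μ • imulVec a b := by
  ext <;> simp [imulVec] <;> ring

/-- `supZ v ≤ M` for `v ∈ cube M`. [folklore] -/
theorem supZ_le_of_mem_cube {M : ℝ} {v : ℤ × ℤ × ℤ} (h : v ∈ cube M) : (supZ v : ℝ) ≤ M := by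
  obtain ⟨h1, h2, h3⟩ := abs_le_of_mem_cube h
  have : ((supZ v : ℤ) : ℝ) = max |(v.1 : ℝ)| (max |(v.2.1 : ℝ)| |(v.2.2 : ℝ)|) := by
    simp only [supZ]; push_cast; rfl
  rw [this]
  exact max_le h1 (max_le h2 h3)

/-- **Two `β̂` sharing an `α̂` with `W = 1` are not parallel** (if `β̂₂ = μβ̂₁` then `x₂ = μ x₁` with
`X < x₁, x₂ ≤ 2X`, forcing `μ = 1`). [cite: HeathBrownActa2001, §11 p. 69] -/
theorem cross3_ne_zero_of_Wab (hX : 0 ≤ X) (hη1 : η ≤ 1) {a b₁ b₂ : ℤ × ℤ × ℤ} (h₁ : IsPrimitiveVec b₁)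
    (hne : b₁ ≠ b₂) (hW₁ : Wab X η a b₁) (hW₂ : Wab X η a b₂) : cross3 b₁ b₂ ≠ 0 := by
  intro h0
  obtain ⟨μ, hμ⟩ := exists_eq_smul_of_cross3_eq_zero h₁ h0
  rw [Wab, mem_boxVec_iff] at hW₁ hW₂
  obtain ⟨xy₁, hxy₁, e₁⟩ := hW₁
  obtain ⟨xy₂, hxy₂, e₂⟩ := hW₂
  rw [hμ, imulVec_smul_right, ← e₁] at e₂
  have hx : (xy₂.1 : ℤ) = μ * xy₁.1 := by
    have := congrArg Prod.fst e₂; simpa using this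
  rw [mem_box_iff] at hxy₁ hxy₂
  obtain ⟨a1, a2, -, -⟩ := hxy₁
  obtain ⟨c1, c2, -, -⟩ := hxy₂
  have hx1pos : (0 : ℝ) < xy₁.1 := lt_of_le_of_lt hX a1
  have hxR : (xy₂.1 : ℝ) = (μ : ℝ) * xy₁.1 := by exact_mod_cast hx
  -- `μ ≥ 1` and `μ < 2`
  have hμ1 : (0 : ℝ) < μ := by
    have : (0 : ℝ) < xy₂.1 := lt_of_le_of_lt hX c1
    rw [hxR] at this
    exact pos_of_mul_pos_left this hx1pos.le
  have hμ2 : (μ : ℝ) < 2 := by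
    by_contra h; push Not at h
    have : (xy₂.1 : ℝ) ≥ 2 * xy₁.1 := by rw [hxR]; nlinarith
    nlinarith
  have hμZ : μ = 1 := by
    have a : (0 : ℤ) < μ := by exact_mod_cast hμ1
    have b : μ < (2 : ℤ) := by exact_mod_cast hμ2
    omega
  rw [hμZ, one_smul] at hμ
  exact hne hμ.symm

/-- **`|β̂₁ ∧ β̂₂|_∞ = D |α̂|_∞ ≤ D · 7X/T`** for a pair sharing the primitive `α̂ ∈ Abox`
((11.4) with (11.6)). [cite: HeathBrownActa2001, §11 (11.7)] -/
theorem supZ_cross3_le_of_Wab {a b₁ b₂ : ℤ × ℤ × ℤ} (ha : a ∈ Abox X T)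
    (hprim : IsPrimitiveVec a) (hW₁ : Wab X η a b₁) (hW₂ : Wab X η a b₂) (hv : cross3 b₁ b₂ ≠ 0) :
    (supZ (cross3 b₁ b₂) : ℝ) ≤ (Dhcf (b₁, b₂) : ℝ) * (7 * X / T) := by
  obtain ⟨ε, hε, heq⟩ := exists_sign_smul_rev_eq hprim (dot3_rev_eq_zero_of_Wab hW₁)
    (dot3_rev_eq_zero_of_Wab hW₂) hv
  have h1 : supZ (cross3 b₁ b₂) = supZ (ε • cross3 b₁ b₂) := by
    rw [supZ_smul]; rcases hε with rfl | rfl <;> simp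
  have h2 : supZ (ε • cross3 b₁ b₂) = (hcf3 (cross3 b₁ b₂) : ℤ) * supZ a := by
    rw [← heq, supZ_smul, supZ_rev, abs_of_nonneg (by positivity)]
  have ha' : (supZ a : ℝ) ≤ 7 * X / T := supZ_le_of_mem_cube ha
  have hD0 : (0 : ℝ) ≤ (hcf3 (cross3 b₁ b₂) : ℝ) := by positivity
  rw [h1, h2, Dhcf]
  push_cast
  exact mul_le_mul_of_nonneg_left ha' hD0

/-! ### Counting `β̂₂` for fixed `β̂₁` and `D`: residue classes and the cylinder -/

open scoped Classical in
/-- **For fixed primitive `β̂₁` and `D ≥ 1`**, the `β̂₂ ∈ Bbox` with `D ∣ β̂₁ ∧ β̂₂` and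
`|β̂₁ ∧ β̂₂|_∞ ≤ Dρ` number at most `D (6T/D + 1)(2ρ/|β̂₁|_∞ + 1)²`: `β̂₂ ≡ λβ̂₁ (mod D)` for one of
`D` values of `λ` (Lemma 11.1), and `m = (β̂₂ − λβ̂₁)/D` lies in the cylinder `|β̂₁ ∧ m|_∞ ≤ ρ`,
`|m + λβ̂₁/D|_∞ ≤ 3T/D` ("`β̂₂` is confined to a circular cylinder …", p. 71). [cite: HeathBrownActa2001, §11 p. 71] -/
theorem card_filter_dvd_cross3_le (hT : 0 ≤ T) {b₁ : ℤ × ℤ × ℤ} (hb₁ : IsPrimitiveVec b₁) {D : ℕ} (hD : 1 ≤ D)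
    {ρ : ℝ} (hρ : 0 ≤ ρ) :
    (#((Bbox T).filter (fun b₂ => DvdVec (D : ℤ) (cross3 b₁ b₂) ∧ (supZ (cross3 b₁ b₂) : ℝ) ≤ D * ρ)) : ℝ) ≤
      D * ((6 * T / D + 1) * (2 * ρ / (supZ b₁ : ℝ) + 1) ^ 2) := by
  classical
  have hb0 : b₁ ≠ 0 := hb₁.ne_zero
  have hDpos : (0 : ℝ) < D := by exact_mod_cast hD
  have hDZ : (D : ℤ) ≠ 0 := by exact_mod_cast (show D ≠ 0 by omega)
  obtain ⟨c, hc⟩ := exists_dot_eq_one hb₁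
  set S := (Bbox T).filter (fun b₂ => DvdVec (D : ℤ) (cross3 b₁ b₂) ∧ (supZ (cross3 b₁ b₂) : ℝ) ≤ D * ρ) with hS
  -- residue of `λ`
  set lam : ℤ × ℤ × ℤ → ℤ := fun b₂ => (c.1 * b₂.1 + c.2.1 * b₂.2.1 + c.2.2 * b₂.2.2) % D with hlam
  have hlam_mem : ∀ b₂, lam b₂ ∈ Ico (0 : ℤ) D := fun b₂ => by
    rw [mem_Ico]; exact ⟨Int.emod_nonneg _ hDZ, Int.emod_lt_of_pos _ (by exact_mod_cast hD)⟩
  have himg : #(S.image lam) ≤ D := by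
    calc #(S.image lam) ≤ #(Ico (0 : ℤ) D) := card_le_card (image_subset_iff.mpr fun b₂ _ => hlam_mem b₂)
      _ = D := by rw [Int.card_Ico]; simp
  -- divisibility of `b₂ - lam b₂ • b₁`
  have hdvd : ∀ b₂ ∈ S, DvdVec (D : ℤ) (b₂ - lam b₂ • b₁) := by
    intro b₂ hb₂
    rw [hS, mem_filter] at hb₂
    have h := modEq_smul_of_dvd_cross3 hc hb₂.2.1
    set L : ℤ := c.1 * b₂.1 + c.2.1 * b₂.2.1 + c.2.2 * b₂.2.2 with hL
    have hq : b₂ - lam b₂ • b₁ = (b₂ - L • b₁) + (D : ℤ) • ((L / D) • b₁) := by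
      have : lam b₂ = L - D * (L / D) := by rw [hlam]; simp only; rw [Int.emod_def]
      rw [this, smul_smul, sub_smul, mul_smul]
      abel
    rw [hq]
    obtain ⟨d1, d2, d3⟩ := h
    refine ⟨?_, ?_, ?_⟩ <;>
      simp only [Prod.fst_add, Prod.snd_add, Prod.smul_fst, Prod.smul_snd, smul_eq_mul]
    · exact dvd_add d1 (dvd_mul_right _ _)
    · exact dvd_add d2 (dvd_mul_right _ _)
    · exact dvd_add d3 (dvd_mul_right _ _)
  -- the fibre map `m`
  set mfun : ℤ × ℤ × ℤ → ℤ × ℤ × ℤ := fun b₂ => divVec (b₂ - lam b₂ • b₁) D with hmfun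
  have hm_smul : ∀ b₂ ∈ S, (D : ℤ) • mfun b₂ = b₂ - lam b₂ • b₁ := fun b₂ hb₂ => smul_divVec (hdvd b₂ hb₂)
  -- fibre bound
  have hfib : ∀ r ∈ S.image lam, (#(S.filter (fun b₂ => lam b₂ = r)) : ℝ) ≤
      (6 * T / D + 1) * (2 * ρ / (supZ b₁ : ℝ) + 1) ^ 2 := by
    intro r _
    set F := S.filter (fun b₂ => lam b₂ = r) with hF
    have hinj : Set.InjOn mfun (F : Set (ℤ × ℤ × ℤ)) := by
      intro x hx y hy hxy
      simp only [hF, coe_filter, Set.mem_setOf_eq] at hx hy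
      have ex := hm_smul x hx.1
      have ey := hm_smul y hy.1
      rw [hxy] at ex
      rw [ex, hx.2, hy.2] at ey
      -- `x - r b₁ = y - r b₁`
      exact sub_left_injective ey
    rw [← card_image_of_injOn hinj]
    -- every image point is in the cylinder
    have hall : ∀ mm ∈ F.image mfun,
        (|((cross3 b₁ mm).1 : ℝ)| ≤ ρ ∧ |((cross3 b₁ mm).2.1 : ℝ)| ≤ ρ ∧ |((cross3 b₁ mm).2.2 : ℝ)| ≤ ρ) ∧
          (|(mm.1 : ℝ) - (-(r : ℝ) * b₁.1 / D)| ≤ 3 * T / D ∧ |(mm.2.1 : ℝ) - (-(r : ℝ) * b₁.2.1 / D)| ≤ 3 * T / D ∧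
            |(mm.2.2 : ℝ) - (-(r : ℝ) * b₁.2.2 / D)| ≤ 3 * T / D) := by
      intro mm hmm
      obtain ⟨b₂, hb₂F, rfl⟩ := mem_image.mp hmm
      rw [hF, mem_filter] at hb₂F
      obtain ⟨hb₂S, hr⟩ := hb₂F
      have hsm := hm_smul b₂ hb₂S
      have hb₂S' := hb₂S
      rw [hS, mem_filter] at hb₂S'
      obtain ⟨hBbox, -, hsup⟩ := hb₂S'
      -- cross product of `m`
      have hcr : (D : ℤ) • cross3 b₁ (mfun b₂) = cross3 b₁ b₂ := by
        rw [← cross3_smul_right, hsm, cross3_sub_right, cross3_smul_right, cross3_self, smul_zero, sub_zero]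
      obtain ⟨s1, s2, s3⟩ := abs_cast_le_supZ (cross3 b₁ b₂)
      have key : ∀ (p q : ℤ), (D : ℤ) * p = q → |(q : ℝ)| ≤ (supZ (cross3 b₁ b₂) : ℝ) → |(p : ℝ)| ≤ ρ := by
        intro p q hpq hq
        have : (q : ℝ) = D * p := by exact_mod_cast hpq.symm
        rw [this, abs_mul, abs_of_pos hDpos] at hq
        have := hq.trans hsup
        exact le_of_mul_le_mul_left (by linarith) hDpos
      refine ⟨⟨key _ _ (by have := congrArg Prod.fst hcr; simpa using this) s1,
        key _ _ (by have := congrArg (fun p => p.2.1) hcr; simpa using this) s2,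
        key _ _ (by have := congrArg (fun p => p.2.2) hcr; simpa using this) s3⟩, ?_⟩
      -- the centre
      obtain ⟨c1, c2, c3⟩ := abs_le_of_mem_cube hBbox
      have key2 : ∀ (mi bi b2i : ℤ), (D : ℤ) * mi = b2i - r * bi → |(b2i : ℝ)| ≤ 3 * T →
          |(mi : ℝ) - (-(r : ℝ) * bi / D)| ≤ 3 * T / D := by
        intro mi bi b2i h hb
        have hR : (mi : ℝ) = ((b2i : ℝ) - r * bi) / D := by
          rw [eq_div_iff hDpos.ne']; exact_mod_cast (by rw [mul_comm]; exact h)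
        rw [hR, show ((b2i : ℝ) - r * bi) / D - -(r : ℝ) * bi / D = (b2i : ℝ) / D by ring, abs_div,
          abs_of_pos hDpos]
        exact div_le_div_of_nonneg_right hb hDpos.le
      rw [hr] at hsm
      refine ⟨key2 _ _ _ (by have := congrArg Prod.fst hsm; simpa using this) c1,
        key2 _ _ _ (by have := congrArg (fun p => p.2.1) hsm; simpa using this) c2,
        key2 _ _ _ (by have := congrArg (fun p => p.2.2) hsm; simpa using this) c3⟩
    have hcyl := card_filter_abs_cross3_le hb0 hρ (by positivity : (0 : ℝ) ≤ 3 * T / D)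
      ((-(r : ℝ) * b₁.1 / D), (-(r : ℝ) * b₁.2.1 / D), (-(r : ℝ) * b₁.2.2 / D)) (F.image mfun)
    rw [filter_true_of_mem hall] at hcyl
    calc (#(F.image mfun) : ℝ) ≤ (2 * (3 * T / D) + 1) * (2 * ρ / (supZ b₁ : ℝ) + 1) ^ 2 := hcyl
      _ = (6 * T / D + 1) * (2 * ρ / (supZ b₁ : ℝ) + 1) ^ 2 := by ring
  -- assemble
  have hsum : #S = ∑ r ∈ S.image lam, #(S.filter (fun b₂ => lam b₂ = r)) := card_eq_sum_card_image lam S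
  have himgR : (#(S.image lam) : ℝ) ≤ D := by exact_mod_cast himg
  calc (#S : ℝ) = ∑ r ∈ S.image lam, (#(S.filter (fun b₂ => lam b₂ = r)) : ℝ) := by rw [hsum]; push_cast; rfl
    _ ≤ ∑ _r ∈ S.image lam, (6 * T / D + 1) * (2 * ρ / (supZ b₁ : ℝ) + 1) ^ 2 := sum_le_sum hfib
    _ = #(S.image lam) * ((6 * T / D + 1) * (2 * ρ / (supZ b₁ : ℝ) + 1) ^ 2) := by rw [sum_const, nsmul_eq_mul]
    _ ≤ D * ((6 * T / D + 1) * (2 * ρ / (supZ b₁ : ℝ) + 1) ^ 2) := by gcongr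

open scoped Classical in
/-- **Summing over `D ≤ Δ₀`**: for primitive `β̂₁` with `|β̂₁|_∞ > T/4`, the `β̂₂ ∈ Bbox` with
`β̂₁ ∧ β̂₂ ≠ 0`, `D = h.c.f.(β̂₁ ∧ β̂₂) ≤ Δ₀` and `|β̂₁ ∧ β̂₂|_∞ ≤ Dρ` number at most
`Δ₀ (6T + Δ₀)(8ρ/T + 1)²` ("We may now sum over all `D ≤ VX⁻¹Y⁻¹`", p. 71). [cite: HeathBrownActa2001, §11 p. 71] -/
theorem card_b2_le (hT : 0 < T) {b₁ : ℤ × ℤ × ℤ} (hb₁ : IsPrimitiveVec b₁) (hsup : T / 4 < (supZ b₁ : ℝ))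
    {ρ Δ₀ : ℝ} (hρ : 0 ≤ ρ) (hΔ : 0 ≤ Δ₀) :
    (#((Bbox T).filter (fun b₂ => cross3 b₁ b₂ ≠ 0 ∧ (Dhcf (b₁, b₂) : ℝ) ≤ Δ₀ ∧
        (supZ (cross3 b₁ b₂) : ℝ) ≤ (Dhcf (b₁, b₂) : ℝ) * ρ)) : ℝ) ≤
      Δ₀ * (6 * T + Δ₀) * (8 * ρ / T + 1) ^ 2 := by
  classical
  set N : ℕ := ⌊Δ₀⌋₊ with hN
  -- cover by the sets of the previous lemma
  have hcover : (Bbox T).filter (fun b₂ => cross3 b₁ b₂ ≠ 0 ∧ (Dhcf (b₁, b₂) : ℝ) ≤ Δ₀ ∧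
      (supZ (cross3 b₁ b₂) : ℝ) ≤ (Dhcf (b₁, b₂) : ℝ) * ρ) ⊆
      (Icc 1 N).biUnion (fun D => (Bbox T).filter
        (fun b₂ => DvdVec (D : ℤ) (cross3 b₁ b₂) ∧ (supZ (cross3 b₁ b₂) : ℝ) ≤ D * ρ)) := by
    intro b₂ hb₂
    rw [mem_filter] at hb₂
    obtain ⟨hB, hv, hDle, hs⟩ := hb₂
    rw [mem_biUnion]
    refine ⟨Dhcf (b₁, b₂), ?_, ?_⟩
    · rw [mem_Icc]
      exact ⟨one_le_hcf3 hv, Nat.le_floor hDle⟩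
    · rw [mem_filter]
      exact ⟨hB, hcf3_dvd _, hs⟩
  have hsupb : (0 : ℝ) < supZ b₁ := by linarith [show (0:ℝ) < T / 4 by positivity]
  calc (#((Bbox T).filter (fun b₂ => cross3 b₁ b₂ ≠ 0 ∧ (Dhcf (b₁, b₂) : ℝ) ≤ Δ₀ ∧
          (supZ (cross3 b₁ b₂) : ℝ) ≤ (Dhcf (b₁, b₂) : ℝ) * ρ)) : ℝ)
      ≤ #((Icc 1 N).biUnion (fun D => (Bbox T).filter
          (fun b₂ => DvdVec (D : ℤ) (cross3 b₁ b₂) ∧ (supZ (cross3 b₁ b₂) : ℝ) ≤ D * ρ))) := by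
        exact_mod_cast card_le_card hcover
    _ ≤ ∑ D ∈ Icc 1 N, (#((Bbox T).filter
          (fun b₂ => DvdVec (D : ℤ) (cross3 b₁ b₂) ∧ (supZ (cross3 b₁ b₂) : ℝ) ≤ D * ρ)) : ℝ) := by
        exact_mod_cast card_biUnion_le
    _ ≤ ∑ D ∈ Icc 1 N, (D : ℝ) * ((6 * T / D + 1) * (2 * ρ / (supZ b₁ : ℝ) + 1) ^ 2) := by
        refine sum_le_sum fun D hD => ?_
        rw [mem_Icc] at hD
        exact card_filter_dvd_cross3_le hT.le hb₁ hD.1 hρ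
    _ ≤ ∑ D ∈ Icc 1 N, (6 * T + Δ₀) * (8 * ρ / T + 1) ^ 2 := by
        refine sum_le_sum fun D hD => ?_
        rw [mem_Icc] at hD
        have hD0 : (0 : ℝ) < D := by exact_mod_cast hD.1
        have hDΔ : (D : ℝ) ≤ Δ₀ := by
          have : (D : ℝ) ≤ N := by exact_mod_cast hD.2
          exact this.trans (Nat.floor_le hΔ)
        have e1 : (D : ℝ) * ((6 * T / D + 1)) = 6 * T + D := by field_simp
        have e2 : 2 * ρ / (supZ b₁ : ℝ) ≤ 8 * ρ / T := by
          rw [div_le_div_iff₀ hsupb hT]; nlinarith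
        calc (D : ℝ) * ((6 * T / D + 1) * (2 * ρ / (supZ b₁ : ℝ) + 1) ^ 2)
            = (6 * T + D) * (2 * ρ / (supZ b₁ : ℝ) + 1) ^ 2 := by rw [← mul_assoc, e1]
          _ ≤ (6 * T + Δ₀) * (8 * ρ / T + 1) ^ 2 := by
              gcongr
    _ = N * ((6 * T + Δ₀) * (8 * ρ / T + 1) ^ 2) := by rw [sum_const, Nat.card_Icc, nsmul_eq_mul]; simp
    _ ≤ Δ₀ * ((6 * T + Δ₀) * (8 * ρ / T + 1) ^ 2) := by
        gcongr; exact Nat.floor_le hΔ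
    _ = Δ₀ * (6 * T + Δ₀) * (8 * ρ / T + 1) ^ 2 := by ring

/-! ### The bound for `S₃` -/

/-- `hcf3 (-v) = hcf3 v`. [folklore] -/
theorem hcf3_neg (v : ℤ × ℤ × ℤ) : hcf3 (-v) = hcf3 v := by
  simp [hcf3, Int.gcd_neg, Int.neg_gcd]

/-- `D(β̂₂, β̂₁) = D(β̂₁, β̂₂)`. [folklore] -/
theorem Dhcf_swap (bb : (ℤ × ℤ × ℤ) × (ℤ × ℤ × ℤ)) : Dhcf bb.swap = Dhcf bb := by
  rw [Dhcf, Dhcf, Prod.fst_swap, Prod.snd_swap, cross3_swap, hcf3_neg]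

open scoped Classical in
/-- `#{α̂}` is symmetric in the pair. [folklore] -/
theorem nAB_swap (bb : (ℤ × ℤ × ℤ) × (ℤ × ℤ × ℤ)) : nAB X η T bb.swap = nAB X η T bb := by
  classical
  rw [nAB, nAB]
  congr 1
  refine filter_congr fun a _ => ?_
  simp only [Prod.fst_swap, Prod.snd_swap]
  tauto

open scoped Classical in
/-- `nAB ≠ 0` produces a primitive `α̂ ∈ Abox` with `W(α̂β̂₁) = W(α̂β̂₂) = 1`. [folklore] -/
theorem exists_of_nAB_ne_zero {bb : (ℤ × ℤ × ℤ) × (ℤ × ℤ × ℤ)} (h : nAB X η T bb ≠ 0) :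
    ∃ a ∈ Abox X T, IsPrimitiveVec a ∧ Wab X η a bb.1 ∧ Wab X η a bb.2 := by
  classical
  rw [nAB, Ne, card_eq_zero, ← Ne, ← nonempty_iff_ne_empty] at h
  obtain ⟨a, ha⟩ := h
  rw [mem_filter] at ha
  exact ⟨a, ha.1, ha.2⟩

/-- The window lower bound on the sup norm of `β̂`: `|β̂|_∞ > T/4`. [cite: HeathBrownActa2001, §11 (11.5)] -/
theorem supZ_gt_of_inWindow (hT : 0 < T) {b : ℤ × ℤ × ℤ} (hw : InWindow T (coordElt b)) :
    T / 4 < (supZ b : ℝ) := by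
  have h1 : T < ell (castVec b) := by have := hw.1; rwa [ellO_coordElt] at this
  have h := exists_abs_coord_gt_of_inWindow hT h1
  have : ((supZ b : ℤ) : ℝ) = max |(b.1 : ℝ)| (max |(b.2.1 : ℝ)| |(b.2.2 : ℝ)|) := by
    simp only [supZ]; push_cast; rfl
  rw [this]; exact h

open scoped Classical in
/-- **The termwise bound `|F_{β₁}F_{β₂}| · #{α̂} ≤ F_{β₁}² + F_{β₂}²`** ("`|F_{β₁}F_{β₂}| ≤ ½(|F_{β₁}|² + |F_{β₂}|²)`"
and at most two `α̂`). [cite: HeathBrownActa2001, §11 p. 70] -/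
theorem abs_term_le (hX : 0 ≤ X) (hη1 : η ≤ 1) {bb : (ℤ × ℤ × ℤ) × (ℤ × ℤ × ℤ)} (hbb : bb ∈ (Bbox T).offDiag) :
    |Fb X τ m V T bb.1 * Fb X τ m V T bb.2 * nAB X η T bb| ≤ Fb X τ m V T bb.1 ^ 2 + Fb X τ m V T bb.2 ^ 2 := by
  classical
  by_cases hn : nAB X η T bb = 0
  · rw [hn]; simp; positivity
  by_cases hF : Fb X τ m V T bb.1 = 0
  · rw [hF]; simp; positivity
  obtain ⟨-, hprim, -, -⟩ := support_of_Fb_ne_zero hF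
  obtain ⟨a, -, -, hW1, hW2⟩ := exists_of_nAB_ne_zero hn
  have hne : bb.1 ≠ bb.2 := (mem_offDiag.mp hbb).2.2
  have hv : cross3 bb.1 bb.2 ≠ 0 := cross3_ne_zero_of_Wab hX hη1 hprim hne hW1 hW2
  have hn2 : (nAB X η T bb : ℝ) ≤ 2 := by exact_mod_cast nAB_le_two hv
  rw [abs_mul, abs_mul, Nat.abs_cast]
  have h2ab : 2 * (|Fb X τ m V T bb.1| * |Fb X τ m V T bb.2|) ≤ Fb X τ m V T bb.1 ^ 2 + Fb X τ m V T bb.2 ^ 2 := by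
    rw [← sq_abs (Fb X τ m V T bb.1), ← sq_abs (Fb X τ m V T bb.2)]
    nlinarith [sq_nonneg (|Fb X τ m V T bb.1| - |Fb X τ m V T bb.2|)]
  calc |Fb X τ m V T bb.1| * |Fb X τ m V T bb.2| * (nAB X η T bb : ℝ)
      ≤ |Fb X τ m V T bb.1| * |Fb X τ m V T bb.2| * 2 := by gcongr
    _ ≤ _ := by linarith

open scoped Classical in
/-- **`S₃ ≪ VXY⁻¹(log X)^c`** in the raw form: for `Δ₀ ≥ 0`,
`|S₃| ≤ 2 (∑_{β̂ ∈ Bbox} F_β²) · Δ₀ (6T + Δ₀)(56X/T² + 1)²` (the sum is `≪ V(log V)^c` by Lemma 4.5,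
and with `Δ₀ = V/(XY)`, `T = V^{1/3}` the product is `≪ VXY⁻¹`). [cite: HeathBrownActa2001, §11 p. 71] -/
theorem abs_S3sum_le (hX : 0 ≤ X) (hη1 : η ≤ 1) (hT : 0 < T) {Δ₀ : ℝ} (hΔ : 0 ≤ Δ₀) :
    |S3sum X η τ m V T Δ₀| ≤
      2 * (∑ b ∈ Bbox T, Fb X τ m V T b ^ 2) * (Δ₀ * (6 * T + Δ₀) * (56 * X / T ^ 2 + 1) ^ 2) := by
  classical
  set P := ((Bbox T).offDiag).filter (fun bb => (Dhcf bb : ℝ) ≤ Δ₀ ∧ nAB X η T bb ≠ 0) with hP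
  set g : ℤ × ℤ × ℤ → ℝ := fun b => Fb X τ m V T b ^ 2 with hg
  -- Step 1: `|S₃| ≤ ∑_P (F₁² + F₂²)`
  have h1 : |S3sum X η τ m V T Δ₀| ≤ ∑ bb ∈ P, (g bb.1 + g bb.2) := by
    rw [S3sum]
    refine (abs_sum_le_sum_abs _ _).trans ?_
    rw [← sum_filter_of_ne (p := fun bb => nAB X η T bb ≠ 0) (fun bb _ hne => by
      intro h0; apply hne; rw [h0]; simp), filter_filter, ← hP]
    refine sum_le_sum fun bb hbb => ?_
    rw [hP, mem_filter] at hbb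
    exact abs_term_le hX hη1 hbb.1
  -- Step 2: symmetry `∑_P g(b₂) = ∑_P g(b₁)`
  have hPswap : ∀ bb, bb ∈ P ↔ bb.swap ∈ P := by
    intro bb
    simp only [hP, mem_filter, mem_offDiag, Prod.fst_swap, Prod.snd_swap, Dhcf_swap, nAB_swap]
    tauto
  have h2 : ∑ bb ∈ P, g bb.2 = ∑ bb ∈ P, g bb.1 := by
    refine Finset.sum_nbij' Prod.swap Prod.swap (fun bb hbb => ?_) (fun bb hbb => ?_)
      (fun bb _ => Prod.swap_swap bb) (fun bb _ => Prod.swap_swap bb) (fun bb _ => rfl)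
    · exact (hPswap bb).mp hbb
    · exact (hPswap bb).mp hbb
  have h12 : ∑ bb ∈ P, (g bb.1 + g bb.2) = 2 * ∑ bb ∈ P, g bb.1 := by
    rw [sum_add_distrib, h2]; ring
  -- Step 3: `∑_P g(b₁) ≤ (∑_b g b) · Bnd`
  set Bnd : ℝ := Δ₀ * (6 * T + Δ₀) * (56 * X / T ^ 2 + 1) ^ 2 with hBnd
  have hBnd0 : 0 ≤ Bnd := by positivity
  have hPsub : P ⊆ Bbox T ×ˢ Bbox T := by
    intro bb hbb
    rw [hP, mem_filter, mem_offDiag] at hbb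
    exact mem_product.mpr ⟨hbb.1.1, hbb.1.2.1⟩
  have h3 : ∑ bb ∈ P, g bb.1 ≤ (∑ b ∈ Bbox T, g b) * Bnd := by
    -- write the sum over `P` as a double sum
    have e : ∑ bb ∈ P, g bb.1 = ∑ b₁ ∈ Bbox T, g b₁ * #((Bbox T).filter (fun b₂ => (b₁, b₂) ∈ P)) := by
      have : P = (Bbox T ×ˢ Bbox T).filter (fun bb => bb ∈ P) := by
        ext bb; simp only [mem_filter]; exact ⟨fun h => ⟨hPsub h, h⟩, fun h => h.2⟩
      conv_lhs => rw [this]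
      rw [sum_filter, sum_product]
      refine sum_congr rfl fun b₁ _ => ?_
      rw [← sum_filter]
      simp only
      rw [sum_const, nsmul_eq_mul, mul_comm]
    rw [e, sum_mul]
    refine sum_le_sum fun b₁ hb₁ => ?_
    by_cases hF : Fb X τ m V T b₁ = 0
    · simp only [hg, hF]; simp
    refine mul_le_mul_of_nonneg_left ?_ (by positivity)
    obtain ⟨hw, hprim, -, -⟩ := support_of_Fb_ne_zero hF
    have hsup := supZ_gt_of_inWindow hT hw
    refine le_trans ?_ (card_b2_le hT hprim hsup (by positivity : (0 : ℝ) ≤ 7 * X / T) hΔ |>.trans (le_of_eq ?_))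
    · refine Nat.cast_le.mpr (card_le_card fun b₂ hb₂ => ?_)
      rw [mem_filter] at hb₂ ⊢
      obtain ⟨hB2, hmem⟩ := hb₂
      rw [hP, mem_filter, mem_offDiag] at hmem
      obtain ⟨⟨-, -, hne⟩, hD, hn⟩ := hmem
      obtain ⟨a, ha, haprim, hW1, hW2⟩ := exists_of_nAB_ne_zero hn
      have hv : cross3 b₁ b₂ ≠ 0 := cross3_ne_zero_of_Wab hX hη1 hprim hne hW1 hW2
      exact ⟨hB2, hv, hD, supZ_cross3_le_of_Wab ha haprim hW1 hW2 hv⟩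
    · rw [hBnd]; congr 2; field_simp; ring
  calc |S3sum X η τ m V T Δ₀| ≤ ∑ bb ∈ P, (g bb.1 + g bb.2) := h1
    _ = 2 * ∑ bb ∈ P, g bb.1 := h12
    _ ≤ 2 * ((∑ b ∈ Bbox T, g b) * Bnd) := by gcongr
    _ = 2 * (∑ b ∈ Bbox T, Fb X τ m V T b ^ 2) * Bnd := by rw [hg]; ring

/-- **`∑_{β̂ ∈ Bbox} F_β² ≪ V (log V)^c`** (Lemma 4.5 for `τ²` on the cube `|β̂|_∞ ≤ 3T`):
`∑ F² ≤ C T³ (log(6T + 2))^e` for `T ≥ 1` and admissible `𝐦`. [cite: HeathBrownActa2001, Lemma 4.5] -/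
theorem exists_sum_Fb_sq_le :
    ∃ C : ℝ, ∃ e : ℕ, 0 < C ∧ ∀ (X τ V T : ℝ) (n : ℕ) (m : Fin (n + 1) → ℕ),
      1 < X → 0 < τ → τ ≤ 1 → 1 ≤ T → CoreAdmissible τ m →
        ∑ b ∈ Bbox T, Fb X τ m V T b ^ 2 ≤ C * T ^ 3 * Real.log (6 * T + 2) ^ e := by
  classical
  obtain ⟨C, e, hC, h⟩ := exists_sum_box_idealDivisorCount_pow_le 2
  refine ⟨81 * 27 * C, e, by positivity, ?_⟩
  intro X τ V T n m hX hτ hτ1 hT hm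
  have h3 := h (3 * T) (by linarith)
  calc ∑ b ∈ Bbox T, Fb X τ m V T b ^ 2 ≤ ∑ b ∈ Bbox T, 81 * (idealDivisorCount (Ideal.span {coordElt b}) : ℝ) ^ 2 :=
        sum_le_sum fun b _ => Fb_sq_le hX hτ hτ1 hm b
    _ = 81 * ∑ b ∈ Bbox T, (idealDivisorCount (Ideal.span {coordElt b}) : ℝ) ^ 2 := by rw [mul_sum]
    _ ≤ 81 * (C * (3 * T) ^ 3 * Real.log (2 * (3 * T) + 2) ^ e) := by
        gcongr; exact h3
    _ = 81 * 27 * C * T ^ 3 * Real.log (6 * T + 2) ^ e := by ring_nf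

end Literature.NumberTheory.Sieve.CubicSieve

end
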